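import Summits.QuantumFields.BalabanUV.Beta.GAN24.WilsonVertexSumZero

/-!
# `BalabanUV.Beta.GAN24.WilsonThreeFaceGraded` — binder row G-an2-4 ∕ (CONV-C), W-slot CT-W, route «WC-TL», table fact «3F-REC» ∕ «S3C-REC» (PRICING Q-S3C):
# **THE CUBIC-WILSON FACE LETTER (T-W)_face REDUCES TO ONE FINITE GRADED IDENTITY OF an3's TABLE** — for `3 ≤ Lc`, every exit-face period `Lc^{k+1}` and all
# `(γ, α, β)`: the three-face-legs cell form of `wilsonA d γ` vanishes as soon as the offset-graded sum
# `Σ_{x,z ∈ box1} [cond(γ;α,β; x_α, z_β)]·wilsonA d γ 0 x z (inl α) (inl β)` does, `cond = (α = γ → x_α = 0) ∧ (β = γ → z_β = 0) ∧ (α = β ≠ γ → x_α = z_β)`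

NOT IN PRINT; OUR BOOKKEEPING ([folklore] finite counting over leaf-15's `WilsonVertexSumZero` support API (`suppW_subset_box`, `wilsonA_eq_zero_left ∕ _right`) and an3's
`StepJetData.wilsonA_translate` BY NAME; G-an2-4 formalisation swarm, leaf prover `b2b-balaban-gan24-formalise-leaf-04`, gen 62).  HONEST FRAMING (cell contract,
verbatim): «discharging `BetaPertH` makes Bałaban's UV stability UNCONDITIONAL — a real constructive-QFT result; it is NOT the continuum limit and NOT the Clay
problem.»  HONEST DEPENDENCY (verbatim): «continuum YM on T⁴ ⇐ BetaPertH ∧ nine spine estimates (0/9 proved); BetaPertH ⇐ (D1) ∧ (D4) ∧ CAP+tail; G-an2-4 gates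
asym, D1 and NE2/3/4.»

MECHANISM.  At a slot `u` the weighted pair sum of `wilsonA d γ u` is a finite sum over the offsets `x, z ∈ box1` (support, `tsum_weighted_wilsonA_eq_sum`) of the
slot-independent entries `wilsonA d γ 0 x z` (translation covariance).  Summing the slot over the `γ`-exit face of the period-`P` block against the two leg-face
indicators COUNTS, for each offset pair, the slots `v ∈ box P` with `v_γ ≡ −1`, `v_α + x_α ≡ −1`, `v_β + z_β ≡ −1 (mod P)`; the count factorises over coordinates
(`Finset.sum_prod_piFinset`), each constrained coordinate contributes ONE residue per period (`sum_range_face_shift`) — provided the constraints landing on the same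
coordinate agree, which for offsets in `{−1,0,1}` and `P ≥ 3` is exactly `cond` (`slot_count_eq`: count = `[cond]·N₀`); otherwise two incompatible residues give
zero (`face_shift_incompatible`).  Hence the face form equals `N₀ ·` the graded sum.

WHAT ([folklore]; 0 `def`, 0 cited facts, 0 `def … : Prop`, 0 sorry; generic `d`): §1 `neg_one_emod`, `face_shift_iff`, `face_shift_incompatible`, `sum_range_face_shift`
(+ `_two_eq`, `_two_ne`); §2 `wilsonA_slot_translate`, **`tsum_weighted_wilsonA_eq_sum`** (any leg weights); §3 `abs_le_one_of_mem_box1`, **`slot_count_eq`**;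
§4 **`threeFace_wilsonA_of_graded`** — the hypothesis `hW` of `ThreeFaceRecOfLetters.threeFace_rec_of_wilsonFace` at `(k, γ, α, β)` from the graded identity at
`(γ, α, β)`.  THE GRADED IDENTITY ((W-face), hypothesis, NOT proved here) is a finite statement about an3's explicit table; it holds in exact rational arithmetic at
`d+1 = 2, 3, 4` (99 direction cases, this lineage's `g62/num/graded.py`; in `wc`-language: the graded colour-block sums are symmetric under the leg swap — leaf-15's
`sum_wc_eq_zero` is the ungraded case).  Asserts NO value of Bałaban's tables beyond it; discharges NOTHING of (W-face) ∕ (C)sym ∕ (Q-D) ∕ (Q-D-rate) ∕ «T2Shape» ∕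
«T2Drift» ∕ (hW, hWall); NOT «D1 closed»; NEVER «G-an2-4 closed» as (CONV-C); NOT D1, NOT `BetaPertH`, NOT continuum, NOT Clay.  2026-08-22; no existing file touched.
-/

noncomputable section

open Finset
open scoped BigOperators
open Literature.MathematicalPhysics.QuantumFieldTheory
open Literature.MathematicalPhysics.QuantumFieldTheory.Balaban1983to89
open Literature.MathematicalPhysics.QuantumFieldTheory.Balaban1983to89.Beta

namespace Summit.QuantumFields.BalabanUV.Beta.GAN24.WilsonThreeFaceGraded

/-! ## §1 Residue counting on `[0, P)` -/

/-- [folklore] `(-1) % P = P - 1` for `0 < P`. -/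
theorem neg_one_emod {P : ℤ} (hP : 0 < P) : (-1 : ℤ) % P = P - 1 := by
  have h : (-1 : ℤ) = (P - 1) + P * (-1) := by ring
  rw [h, Int.add_mul_emod_self_left]
  exact Int.emod_eq_of_lt (by omega) (by omega)

/-- [folklore] On `[0, P)`: `(t + r) % P = P − 1 ↔ t = (−1 − r) % P`. -/
theorem face_shift_iff {P : ℤ} (hP : 0 < P) {t : ℤ} (ht0 : 0 ≤ t) (htP : t < P) (r : ℤ) :
    (t + r) % P = P - 1 ↔ t = (-1 - r) % P := by
  constructor
  · intro h
    have h1 : t % P = t := Int.emod_eq_of_lt ht0 htP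
    have h2 : (t + r - r) % P = ((t + r) % P - r % P) % P := Int.sub_emod _ _ _
    rw [add_sub_cancel_right, h, h1] at h2
    rw [h2]
    have h3 : (-1 - r) % P = ((-1) % P - r % P) % P := Int.sub_emod _ _ _
    rw [h3, neg_one_emod hP]
  · intro h
    rw [h]
    have h3 : ((-1 - r) % P + r) % P = ((-1 - r) + r) % P := by
      rw [Int.add_emod, Int.emod_emod_of_dvd _ (dvd_refl P), ← Int.add_emod]
    rw [h3, show (-1 - r + r : ℤ) = -1 by ring, neg_one_emod hP]

/-- [folklore] Two face constraints with shifts `r ≠ r′`, `|r − r′| < P`, are incompatible. -/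
theorem face_shift_incompatible {P : ℤ} (hP : 0 < P) {t r r' : ℤ} (h1 : (t + r) % P = P - 1) (h2 : (t + r') % P = P - 1)
    (hne : r ≠ r') (hsmall : |r - r'| < P) : False := by
  have h : (t + r) % P = (t + r') % P := by rw [h1, h2]
  have hmod : (r - r') % P = 0 := by
    have e : r - r' = (t + r) - (t + r') := by ring
    rw [e, Int.sub_emod, h, sub_self, Int.zero_emod]
  have hdvd : P ∣ r - r' := Int.dvd_of_emod_eq_zero hmod
  rcases hdvd with ⟨c, hc⟩
  have hc0 : c ≠ 0 := by
    rintro rfl; apply hne; linarith [show r - r' = 0 by rw [hc, mul_zero]]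
  have : |r - r'| ≥ P := by
    rw [hc, abs_mul, abs_of_pos hP]
    have : (1 : ℤ) ≤ |c| := Int.one_le_abs hc0
    nlinarith
  linarith

/-- [folklore] **ONE RESIDUE PER PERIOD**: `Σ_{t < P} [((t:ℤ) + r) % P = P − 1] = 1`. -/
theorem sum_range_face_shift {P : ℕ} (hP : 0 < P) (r : ℤ) :
    ∑ t ∈ Finset.range P, (if (((t : ℕ) : ℤ) + r) % (P : ℤ) = (P : ℤ) - 1 then (1 : ℝ) else 0) = 1 := by
  have hP' : (0 : ℤ) < (P : ℤ) := by exact_mod_cast hP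
  set ρ : ℤ := (-1 - r) % (P : ℤ) with hρ
  have hρ0 : 0 ≤ ρ := Int.emod_nonneg _ hP'.ne'
  have hρP : ρ < (P : ℤ) := Int.emod_lt_of_pos _ hP'
  have hmem : ρ.toNat ∈ Finset.range P := by
    rw [Finset.mem_range]
    have : (ρ.toNat : ℤ) < P := by rw [Int.toNat_of_nonneg hρ0]; exact hρP
    exact_mod_cast this
  rw [Finset.sum_eq_single_of_mem ρ.toNat hmem]
  · rw [if_pos]
    rw [Int.toNat_of_nonneg hρ0]
    exact (face_shift_iff hP' hρ0 hρP r).2 rfl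
  · intro t ht hne
    rw [if_neg]
    intro h
    have ht' : ((t : ℕ) : ℤ) < (P : ℤ) := by exact_mod_cast Finset.mem_range.1 ht
    have := (face_shift_iff hP' (by positivity) ht' r).1 h
    apply hne
    have e : (t : ℤ) = ρ := this
    have : t = ρ.toNat := by
      have h2 : ((ρ.toNat : ℕ) : ℤ) = ρ := Int.toNat_of_nonneg hρ0
      exact_mod_cast (e.trans h2.symm)
    exact this

/-- [folklore] **TWO COMPATIBLE CONSTRAINTS = ONE**: with equal shifts the doubly-constrained count is still `1`. -/
theorem sum_range_face_shift_two_eq {P : ℕ} (hP : 0 < P) (r : ℤ) :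
    ∑ t ∈ Finset.range P, (if (((t : ℕ) : ℤ) + r) % (P : ℤ) = (P : ℤ) - 1 then (1 : ℝ) else 0) *
      (if (((t : ℕ) : ℤ) + r) % (P : ℤ) = (P : ℤ) - 1 then (1 : ℝ) else 0) = 1 := by
  conv_rhs => rw [← sum_range_face_shift hP r]
  refine Finset.sum_congr rfl fun t _ => ?_
  split_ifs <;> simp

/-- [folklore] **TWO INCOMPATIBLE CONSTRAINTS = ZERO**: shifts `r ≠ r′` with `|r − r′| < P`. -/
theorem sum_range_face_shift_two_ne {P : ℕ} (hP : 0 < P) {r r' : ℤ} (hne : r ≠ r') (hsmall : |r - r'| < (P : ℤ)) :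
    ∑ t ∈ Finset.range P, (if (((t : ℕ) : ℤ) + r) % (P : ℤ) = (P : ℤ) - 1 then (1 : ℝ) else 0) *
      (if (((t : ℕ) : ℤ) + r') % (P : ℤ) = (P : ℤ) - 1 then (1 : ℝ) else 0) = 0 := by
  have hP' : (0 : ℤ) < (P : ℤ) := by exact_mod_cast hP
  refine Finset.sum_eq_zero fun t _ => ?_
  by_cases h1 : (((t : ℕ) : ℤ) + r) % (P : ℤ) = (P : ℤ) - 1
  · by_cases h2 : (((t : ℕ) : ℤ) + r') % (P : ℤ) = (P : ℤ) - 1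
    · exact (face_shift_incompatible hP' h1 h2 hne hsmall).elim
    · rw [if_neg h2, mul_zero]
  · rw [if_neg h1, zero_mul]


/-! ## §2 The pair sum at a slot is a finite sum over offsets, slot moved to the origin -/

section Slot

variable {d : ℕ}

open StepJetData (wilsonA wilsonA_translate)
open BalabanStepJets (box1)
open ExpKernelCalculus (Site shiftK)
open Summit.QuantumFields.BalabanUV.Beta.GAN24.WilsonVertexSumZero (suppW suppW_subset_box wilsonA_eq_zero_left wilsonA_eq_zero_right)

/-- [folklore] translation of the slot to the origin, entrywise. -/
theorem wilsonA_slot_translate (γ : Fin (d + 1)) (u x z : Site (d + 1)) (a b : OneStepResolventKernel.Fib d) :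
    wilsonA d γ u (u + x) (u + z) a b = wilsonA d γ 0 x z a b := by
  have h := congrFun (congrFun (congrFun (congrFun (wilsonA_translate (d := d) γ 0 u) (u + x)) (u + z)) a) b
  rw [zero_add] at h
  rw [h]
  show wilsonA d γ 0 (u + x + -u) (u + z + -u) a b = wilsonA d γ 0 x z a b
  congr 1 <;> abel

/-- NOT IN PRINT; OUR BOOKKEEPING.  **THE WEIGHTED PAIR SUM OF THE CUBIC WILSON TABLE AT A SLOT IS A FINITE SUM OVER OFFSETS** (support `suppW ⊆ u + box1`,
translation covariance): for any two leg weights `F, G`,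
`Σ'_{(y,w)} F y · G w · wilsonA d γ u y w (inl α)(inl β) = Σ_{x ∈ box1} Σ_{z ∈ box1} F (u+x) · G (u+z) · wilsonA d γ 0 x z (inl α)(inl β)`. -/
theorem tsum_weighted_wilsonA_eq_sum (γ α β : Fin (d + 1)) (u : Site (d + 1)) (F G : Site (d + 1) → ℝ) :
    ∑' yw : Site (d + 1) × Site (d + 1), F yw.1 * G yw.2 * wilsonA d γ u yw.1 yw.2 (Sum.inl α) (Sum.inl β)
      = ∑ x ∈ box1 (d + 1), ∑ z ∈ box1 (d + 1), F (u + x) * G (u + z) * wilsonA d γ 0 x z (Sum.inl α) (Sum.inl β) := by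
  classical
  set S : Finset (Site (d + 1)) := (box1 (d + 1)).image fun v => u + v with hS
  have hsub : suppW γ u ⊆ S := suppW_subset_box γ u
  have hzero : ∀ yw : Site (d + 1) × Site (d + 1), yw ∉ S ×ˢ S →
      F yw.1 * G yw.2 * wilsonA d γ u yw.1 yw.2 (Sum.inl α) (Sum.inl β) = 0 := by
    intro yw hyw
    rw [Finset.mem_product, not_and_or] at hyw
    rcases hyw with h | h
    · rw [wilsonA_eq_zero_left γ u (fun hh => h (hsub hh)), mul_zero]
    · rw [wilsonA_eq_zero_right γ u yw.1 (fun hh => h (hsub hh)), mul_zero]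
  rw [tsum_eq_sum (s := S ×ˢ S) hzero, Finset.sum_product]
  have hinj : ∀ x ∈ box1 (d + 1), ∀ y ∈ box1 (d + 1), u + x = u + y → x = y := fun x _ y _ h => add_left_cancel h
  rw [hS, Finset.sum_image hinj]
  refine Finset.sum_congr rfl fun x _ => ?_
  rw [Finset.sum_image hinj]
  refine Finset.sum_congr rfl fun z _ => ?_
  rw [wilsonA_slot_translate]

end Slot

/-! ## §3 Counting the slots on the exit face compatible with two leg offsets -/

section Count

variable {d : ℕ}

open AffineAveraging (box toSite)
open BalabanStepJets (box1 mem_box1)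

/-- [folklore] coordinates of `box1` offsets are `−1, 0, 1`. -/
theorem abs_le_one_of_mem_box1 {x : Fin (d + 1) → ℤ} (hx : x ∈ box1 (d + 1)) (c : Fin (d + 1)) : |x c| ≤ 1 := by
  have h := (Fintype.mem_piFinset.1 hx) c
  simp only [Finset.mem_insert, Finset.mem_singleton] at h
  rcases h with h | h | h <;> rw [h] <;> simp

/-- NOT IN PRINT; OUR BOOKKEEPING.  **THE SLOT COUNT**: for offsets `x, z ∈ box1` and `3 ≤ P`, the number of slots `v ∈ box P` on the `γ`-exit face whose
`α`-leg at offset `x` and `β`-leg at offset `z` both sit on exit faces equals `[cond] · N₀`, `N₀` the count at zero offsets, with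
`cond = (α = γ → x_α = 0) ∧ (β = γ → z_β = 0) ∧ (α = β → α ≠ γ → x_α = z_β)`. -/
theorem slot_count_eq (P : ℕ) (hP : 3 ≤ P) (γ α β : Fin (d + 1)) {x z : Fin (d + 1) → ℤ} (hx : x ∈ box1 (d + 1)) (hz : z ∈ box1 (d + 1)) :
    ∑ v ∈ box (d + 1) P, (if toSite v γ % (P : ℤ) = (P : ℤ) - 1 then (1 : ℝ) else 0) *
        (if ((toSite v + x) α) % (P : ℤ) = (P : ℤ) - 1 then (1 : ℝ) else 0) * (if ((toSite v + z) β) % (P : ℤ) = (P : ℤ) - 1 then (1 : ℝ) else 0)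
      = (if ((α = γ → x α = 0) ∧ (β = γ → z β = 0) ∧ (α = β → α ≠ γ → x α = z β)) then (1 : ℝ) else 0) *
        ∑ v ∈ box (d + 1) P, (if toSite v γ % (P : ℤ) = (P : ℤ) - 1 then (1 : ℝ) else 0) *
          (if (toSite v α) % (P : ℤ) = (P : ℤ) - 1 then (1 : ℝ) else 0) * (if (toSite v β) % (P : ℤ) = (P : ℤ) - 1 then (1 : ℝ) else 0) := by
  classical
  have hP0 : 0 < P := by omega
  have hPz : (3 : ℤ) ≤ (P : ℤ) := by exact_mod_cast hP
  -- the indicator of a shifted face constraint on coordinate `c` with shift `r`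
  set E : ℤ → ℕ → ℝ := fun r t => if (((t : ℕ) : ℤ) + r) % (P : ℤ) = (P : ℤ) - 1 then 1 else 0 with hE
  -- per-coordinate factor with shifts `(r₀ on γ, r₁ on α, r₂ on β)`
  set f : ℤ → ℤ → Fin (d + 1) → ℕ → ℝ := fun r₁ r₂ c t =>
    (if c = γ then E 0 t else 1) * ((if c = α then E r₁ t else 1) * (if c = β then E r₂ t else 1)) with hf
  -- product form of the summand
  have hprod : ∀ (r₁ r₂ : ℤ) (v : Fin (d + 1) → ℕ),
      (if toSite v γ % (P : ℤ) = (P : ℤ) - 1 then (1 : ℝ) else 0) *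
        (if (toSite v α + r₁) % (P : ℤ) = (P : ℤ) - 1 then (1 : ℝ) else 0) *
        (if (toSite v β + r₂) % (P : ℤ) = (P : ℤ) - 1 then (1 : ℝ) else 0)
      = ∏ c, f r₁ r₂ c (v c) := by
    intro r₁ r₂ v
    simp only [hf, Finset.prod_mul_distrib, Finset.prod_ite_eq', Finset.mem_univ, if_true, hE, toSite, add_zero]
    ring
  -- the sum over the box factorises
  have hfac : ∀ r₁ r₂ : ℤ, ∑ v ∈ box (d + 1) P, ∏ c, f r₁ r₂ c (v c) = ∏ c, ∑ t ∈ Finset.range P, f r₁ r₂ c t := by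
    intro r₁ r₂
    simp only [AffineAveraging.box]
    rw [Finset.sum_prod_piFinset]
  -- rewrite both sides in product form
  have eL : (∑ v ∈ box (d + 1) P, (if toSite v γ % (P : ℤ) = (P : ℤ) - 1 then (1 : ℝ) else 0) *
        (if ((toSite v + x) α) % (P : ℤ) = (P : ℤ) - 1 then (1 : ℝ) else 0) * (if ((toSite v + z) β) % (P : ℤ) = (P : ℤ) - 1 then (1 : ℝ) else 0))
      = ∏ c, ∑ t ∈ Finset.range P, f (x α) (z β) c t := by
    rw [← hfac]
    refine Finset.sum_congr rfl fun v _ => ?_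
    rw [← hprod]
    simp only [Pi.add_apply]
  have eR : (∑ v ∈ box (d + 1) P, (if toSite v γ % (P : ℤ) = (P : ℤ) - 1 then (1 : ℝ) else 0) *
        (if (toSite v α) % (P : ℤ) = (P : ℤ) - 1 then (1 : ℝ) else 0) * (if (toSite v β) % (P : ℤ) = (P : ℤ) - 1 then (1 : ℝ) else 0))
      = ∏ c, ∑ t ∈ Finset.range P, f 0 0 c t := by
    rw [← hfac]
    refine Finset.sum_congr rfl fun v _ => ?_
    rw [← hprod]
    simp only [add_zero]
  rw [eL, eR]
  -- per-coordinate evaluation tools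
  have hxa : |x α| ≤ 1 := abs_le_one_of_mem_box1 hx α
  have hzb : |z β| ≤ 1 := abs_le_one_of_mem_box1 hz β
  have one : ∀ r : ℤ, ∑ t ∈ Finset.range P, E r t = 1 := fun r => sum_range_face_shift hP0 r
  have two_eq : ∀ r : ℤ, ∑ t ∈ Finset.range P, E r t * E r t = 1 := fun r => sum_range_face_shift_two_eq hP0 r
  have two_ne : ∀ r r' : ℤ, r ≠ r' → |r - r'| < (P : ℤ) → ∑ t ∈ Finset.range P, E r t * E r' t = 0 :=
    fun r r' h1 h2 => sum_range_face_shift_two_ne hP0 h1 h2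
  have Enn : ∀ (r : ℤ) (t : ℕ), 0 ≤ E r t := fun r t => by simp only [hE]; split_ifs <;> norm_num
  -- a triple product containing an incompatible pair vanishes termwise
  have three_ne : ∀ r r' r'' : ℤ, r ≠ r' → |r - r'| < (P : ℤ) → ∑ t ∈ Finset.range P, E r t * (E r' t * E r'' t) = 0 := by
    intro r r' r'' h1 h2
    have h0 := two_ne r r' h1 h2
    have hnn : ∀ t ∈ Finset.range P, 0 ≤ E r t * E r' t := fun t _ => mul_nonneg (Enn r t) (Enn r' t)
    refine Finset.sum_eq_zero fun t ht => ?_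
    have ht0 : E r t * E r' t = 0 := (Finset.sum_eq_zero_iff_of_nonneg hnn).1 h0 t ht
    calc E r t * (E r' t * E r'' t) = (E r t * E r' t) * E r'' t := by ring
      _ = 0 := by rw [ht0, zero_mul]
  have small0a : |(0 : ℤ) - x α| < (P : ℤ) := by rw [zero_sub, abs_neg]; linarith
  have small0b : |(0 : ℤ) - z β| < (P : ℤ) := by rw [zero_sub, abs_neg]; linarith
  have smallab : |x α - z β| < (P : ℤ) := by
    have := abs_sub (x α) (z β); linarith
  by_cases hc : (α = γ → x α = 0) ∧ (β = γ → z β = 0) ∧ (α = β → α ≠ γ → x α = z β)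
  · -- compatible offsets: coordinate by coordinate the factors agree
    rw [if_pos hc, one_mul]
    obtain ⟨h1, h2, h3⟩ := hc
    refine Finset.prod_congr rfl fun c _ => ?_
    simp only [hf]
    by_cases hcγ : c = γ
    · -- on the slot coordinate every active shift is `0`
      have hx0 : c = α → x α = 0 := fun h => h1 (h ▸ hcγ)
      have hz0 : c = β → z β = 0 := fun h => h2 (h ▸ hcγ)
      by_cases hcα : c = α
      · by_cases hcβ : c = β
        · simp only [if_pos hcγ, if_pos hcα, if_pos hcβ, hx0 hcα, hz0 hcβ]
        · simp only [if_pos hcγ, if_pos hcα, if_neg hcβ, hx0 hcα]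
      · by_cases hcβ : c = β
        · simp only [if_pos hcγ, if_neg hcα, if_pos hcβ, hz0 hcβ]
        · simp only [if_pos hcγ, if_neg hcα, if_neg hcβ]
    · by_cases hcα : c = α
      · by_cases hcβ : c = β
        · -- `α = β ≠ γ`: equal shifts
          have hxz : x α = z β := h3 (hcα ▸ hcβ) (fun h => hcγ (hcα.trans h))
          simp only [if_neg hcγ, if_pos hcα, if_pos hcβ, one_mul, hxz]
          rw [two_eq, two_eq]
        · simp only [if_neg hcγ, if_pos hcα, if_neg hcβ, one_mul, mul_one]
          rw [one, one]
      · by_cases hcβ : c = β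
        · simp only [if_neg hcγ, if_neg hcα, if_pos hcβ, one_mul]
          rw [one, one]
        · simp only [if_neg hcγ, if_neg hcα, if_neg hcβ]
  · -- incompatible offsets: one coordinate factor vanishes
    rw [if_neg hc, zero_mul]
    simp only [not_and_or, Classical.not_imp] at hc
    rcases hc with ⟨hαγ, hx0⟩ | ⟨hβγ, hz0⟩ | ⟨hαβ, hαγ, hxz⟩
    · apply Finset.prod_eq_zero (Finset.mem_univ γ)
      simp only [hf]
      by_cases hγβ : γ = β
      · simp only [if_pos hαγ.symm, if_pos hγβ]
        exact three_ne 0 (x α) (z β) (Ne.symm hx0) small0a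
      · simp only [if_pos hαγ.symm, if_neg hγβ, mul_one]
        exact two_ne 0 (x α) (Ne.symm hx0) small0a
    · apply Finset.prod_eq_zero (Finset.mem_univ γ)
      simp only [hf]
      by_cases hγα : γ = α
      · simp only [if_pos hγα, if_pos hβγ.symm, if_true]
        have h := three_ne 0 (z β) (x α) (Ne.symm hz0) small0b
        rw [← h]
        exact Finset.sum_congr rfl fun t _ => by ring
      · simp only [if_neg hγα, if_pos hβγ.symm, one_mul]
        exact two_ne 0 (z β) (Ne.symm hz0) small0b
    · apply Finset.prod_eq_zero (Finset.mem_univ α)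
      simp only [hf]
      simp only [if_neg hαγ, if_pos hαβ, one_mul]
      exact two_ne (x α) (z β) hxz smallab

end Count


/-! ## §4 (T-W)_face from the graded table identity (W-face) -/

section Assembly

variable {d : ℕ} {Lc : ℕ}

open StepJetData (wilsonA)
open BalabanStepJets (box1)
open ExpKernelCalculus (Site)
open AffineAveraging (box toSite)

/-- NOT IN PRINT; OUR BOOKKEEPING.  **THE CUBIC-WILSON FACE LETTER (T-W)_face FROM THE FINITE GRADED TABLE IDENTITY (W-face)**: for `3 ≤ Lc`, every `k` and all
`(γ, α, β)`, if the offset-graded sum of the table `wilsonA d γ 0 · · (inl α) (inl β)` under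
`cond = (α = γ → x_α = 0) ∧ (β = γ → z_β = 0) ∧ (α = β → α ≠ γ → x_α = z_β)` vanishes, then the three-face-legs cell form of the cubic Wilson table with exit
faces of period `Lc^{k+1}` vanishes — the hypothesis `hW` of `ThreeFaceRecOfLetters.threeFace_rec_of_wilsonFace` at `(k, γ, α, β)`. -/
theorem threeFace_wilsonA_of_graded (hLc : 3 ≤ Lc) (k : ℕ) (γ α β : Fin (d + 1))
    (hG : ∑ x ∈ box1 (d + 1), ∑ z ∈ box1 (d + 1),
      (if ((α = γ → x α = 0) ∧ (β = γ → z β = 0) ∧ (α = β → α ≠ γ → x α = z β)) then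
        wilsonA d γ 0 x z (Sum.inl α) (Sum.inl β) else 0) = 0) :
    ∑ v ∈ box (d + 1) (Lc ^ (k + 1)), (if toSite v γ % ((Lc ^ (k + 1) : ℕ) : ℤ) = ((Lc ^ (k + 1) : ℕ) : ℤ) - 1 then (1 : ℝ) else 0) *
        ∑' yw : Site (d + 1) × Site (d + 1),
          (if yw.1 α % ((Lc ^ (k + 1) : ℕ) : ℤ) = ((Lc ^ (k + 1) : ℕ) : ℤ) - 1 then (1 : ℝ) else 0) *
            (if yw.2 β % ((Lc ^ (k + 1) : ℕ) : ℤ) = ((Lc ^ (k + 1) : ℕ) : ℤ) - 1 then (1 : ℝ) else 0) *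
            wilsonA d γ (toSite v) yw.1 yw.2 (Sum.inl α) (Sum.inl β) = 0 := by
  classical
  have hP3 : 3 ≤ Lc ^ (k + 1) := le_trans hLc (Nat.le_self_pow (Nat.succ_ne_zero k) Lc)
  -- per slot: finite sum over offsets (support + translation)
  have hslot : ∀ v : Fin (d + 1) → ℕ,
      (∑' yw : Site (d + 1) × Site (d + 1),
          (if yw.1 α % ((Lc ^ (k + 1) : ℕ) : ℤ) = ((Lc ^ (k + 1) : ℕ) : ℤ) - 1 then (1 : ℝ) else 0) *
            (if yw.2 β % ((Lc ^ (k + 1) : ℕ) : ℤ) = ((Lc ^ (k + 1) : ℕ) : ℤ) - 1 then (1 : ℝ) else 0) *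
            wilsonA d γ (toSite v) yw.1 yw.2 (Sum.inl α) (Sum.inl β))
        = ∑ x ∈ box1 (d + 1), ∑ z ∈ box1 (d + 1), (if (toSite v + x) α % ((Lc ^ (k + 1) : ℕ) : ℤ) = ((Lc ^ (k + 1) : ℕ) : ℤ) - 1 then (1 : ℝ) else 0) * (if (toSite v + z) β % ((Lc ^ (k + 1) : ℕ) : ℤ) = ((Lc ^ (k + 1) : ℕ) : ℤ) - 1 then (1 : ℝ) else 0) * wilsonA d γ 0 x z (Sum.inl α) (Sum.inl β) := by
    intro v
    have h := tsum_weighted_wilsonA_eq_sum γ α β (toSite v)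
      (fun y : Site (d + 1) => if y α % ((Lc ^ (k + 1) : ℕ) : ℤ) = ((Lc ^ (k + 1) : ℕ) : ℤ) - 1 then (1 : ℝ) else 0)
      (fun y : Site (d + 1) => if y β % ((Lc ^ (k + 1) : ℕ) : ℤ) = ((Lc ^ (k + 1) : ℕ) : ℤ) - 1 then (1 : ℝ) else 0)
    beta_reduce at h
    exact h
  -- the slot counts
  have hcount : ∀ x ∈ box1 (d + 1), ∀ z ∈ box1 (d + 1),
      ∑ v ∈ box (d + 1) (Lc ^ (k + 1)), (if toSite v γ % ((Lc ^ (k + 1) : ℕ) : ℤ) = ((Lc ^ (k + 1) : ℕ) : ℤ) - 1 then (1 : ℝ) else 0) * (if (toSite v + x) α % ((Lc ^ (k + 1) : ℕ) : ℤ) = ((Lc ^ (k + 1) : ℕ) : ℤ) - 1 then (1 : ℝ) else 0) * (if (toSite v + z) β % ((Lc ^ (k + 1) : ℕ) : ℤ) = ((Lc ^ (k + 1) : ℕ) : ℤ) - 1 then (1 : ℝ) else 0)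
        = (if ((α = γ → x α = 0) ∧ (β = γ → z β = 0) ∧ (α = β → α ≠ γ → x α = z β)) then (1 : ℝ) else 0) *
          (∑ v ∈ box (d + 1) (Lc ^ (k + 1)), (if toSite v γ % ((Lc ^ (k + 1) : ℕ) : ℤ) = ((Lc ^ (k + 1) : ℕ) : ℤ) - 1 then (1 : ℝ) else 0) *
          (if (toSite v α) % ((Lc ^ (k + 1) : ℕ) : ℤ) = ((Lc ^ (k + 1) : ℕ) : ℤ) - 1 then (1 : ℝ) else 0) * (if (toSite v β) % ((Lc ^ (k + 1) : ℕ) : ℤ) = ((Lc ^ (k + 1) : ℕ) : ℤ) - 1 then (1 : ℝ) else 0)) :=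
    fun x hx z hz => slot_count_eq (Lc ^ (k + 1)) hP3 γ α β hx hz
  rw [Finset.sum_congr rfl fun v _ => by rw [hslot v]]
  calc ∑ v ∈ box (d + 1) (Lc ^ (k + 1)), (if toSite v γ % ((Lc ^ (k + 1) : ℕ) : ℤ) = ((Lc ^ (k + 1) : ℕ) : ℤ) - 1 then (1 : ℝ) else 0) *
        ∑ x ∈ box1 (d + 1), ∑ z ∈ box1 (d + 1), (if (toSite v + x) α % ((Lc ^ (k + 1) : ℕ) : ℤ) = ((Lc ^ (k + 1) : ℕ) : ℤ) - 1 then (1 : ℝ) else 0) * (if (toSite v + z) β % ((Lc ^ (k + 1) : ℕ) : ℤ) = ((Lc ^ (k + 1) : ℕ) : ℤ) - 1 then (1 : ℝ) else 0) * wilsonA d γ 0 x z (Sum.inl α) (Sum.inl β)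
      = ∑ x ∈ box1 (d + 1), ∑ z ∈ box1 (d + 1), wilsonA d γ 0 x z (Sum.inl α) (Sum.inl β) *
          ∑ v ∈ box (d + 1) (Lc ^ (k + 1)), (if toSite v γ % ((Lc ^ (k + 1) : ℕ) : ℤ) = ((Lc ^ (k + 1) : ℕ) : ℤ) - 1 then (1 : ℝ) else 0) * (if (toSite v + x) α % ((Lc ^ (k + 1) : ℕ) : ℤ) = ((Lc ^ (k + 1) : ℕ) : ℤ) - 1 then (1 : ℝ) else 0) * (if (toSite v + z) β % ((Lc ^ (k + 1) : ℕ) : ℤ) = ((Lc ^ (k + 1) : ℕ) : ℤ) - 1 then (1 : ℝ) else 0) := by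
        have e1 : ∀ v : Fin (d + 1) → ℕ, (if toSite v γ % ((Lc ^ (k + 1) : ℕ) : ℤ) = ((Lc ^ (k + 1) : ℕ) : ℤ) - 1 then (1 : ℝ) else 0) *
            ∑ x ∈ box1 (d + 1), ∑ z ∈ box1 (d + 1), (if (toSite v + x) α % ((Lc ^ (k + 1) : ℕ) : ℤ) = ((Lc ^ (k + 1) : ℕ) : ℤ) - 1 then (1 : ℝ) else 0) * (if (toSite v + z) β % ((Lc ^ (k + 1) : ℕ) : ℤ) = ((Lc ^ (k + 1) : ℕ) : ℤ) - 1 then (1 : ℝ) else 0) * wilsonA d γ 0 x z (Sum.inl α) (Sum.inl β)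
            = ∑ x ∈ box1 (d + 1), ∑ z ∈ box1 (d + 1), (if toSite v γ % ((Lc ^ (k + 1) : ℕ) : ℤ) = ((Lc ^ (k + 1) : ℕ) : ℤ) - 1 then (1 : ℝ) else 0) * ((if (toSite v + x) α % ((Lc ^ (k + 1) : ℕ) : ℤ) = ((Lc ^ (k + 1) : ℕ) : ℤ) - 1 then (1 : ℝ) else 0) * (if (toSite v + z) β % ((Lc ^ (k + 1) : ℕ) : ℤ) = ((Lc ^ (k + 1) : ℕ) : ℤ) - 1 then (1 : ℝ) else 0) * wilsonA d γ 0 x z (Sum.inl α) (Sum.inl β)) := by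
          intro v
          rw [Finset.mul_sum]
          exact Finset.sum_congr rfl fun x _ => by rw [Finset.mul_sum]
        rw [Finset.sum_congr rfl fun v _ => e1 v, Finset.sum_comm]
        refine Finset.sum_congr rfl fun x _ => ?_
        rw [Finset.sum_comm]
        refine Finset.sum_congr rfl fun z _ => ?_
        rw [Finset.mul_sum]
        exact Finset.sum_congr rfl fun v _ => by ring
    _ = ∑ x ∈ box1 (d + 1), ∑ z ∈ box1 (d + 1), wilsonA d γ 0 x z (Sum.inl α) (Sum.inl β) * ((if ((α = γ → x α = 0) ∧ (β = γ → z β = 0) ∧ (α = β → α ≠ γ → x α = z β)) then (1 : ℝ) else 0) *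
          (∑ v ∈ box (d + 1) (Lc ^ (k + 1)), (if toSite v γ % ((Lc ^ (k + 1) : ℕ) : ℤ) = ((Lc ^ (k + 1) : ℕ) : ℤ) - 1 then (1 : ℝ) else 0) *
          (if (toSite v α) % ((Lc ^ (k + 1) : ℕ) : ℤ) = ((Lc ^ (k + 1) : ℕ) : ℤ) - 1 then (1 : ℝ) else 0) * (if (toSite v β) % ((Lc ^ (k + 1) : ℕ) : ℤ) = ((Lc ^ (k + 1) : ℕ) : ℤ) - 1 then (1 : ℝ) else 0))) := by
        refine Finset.sum_congr rfl fun x hx => Finset.sum_congr rfl fun z hz => ?_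
        rw [hcount x hx z hz]
    _ = (∑ v ∈ box (d + 1) (Lc ^ (k + 1)), (if toSite v γ % ((Lc ^ (k + 1) : ℕ) : ℤ) = ((Lc ^ (k + 1) : ℕ) : ℤ) - 1 then (1 : ℝ) else 0) *
          (if (toSite v α) % ((Lc ^ (k + 1) : ℕ) : ℤ) = ((Lc ^ (k + 1) : ℕ) : ℤ) - 1 then (1 : ℝ) else 0) * (if (toSite v β) % ((Lc ^ (k + 1) : ℕ) : ℤ) = ((Lc ^ (k + 1) : ℕ) : ℤ) - 1 then (1 : ℝ) else 0)) *
        ∑ x ∈ box1 (d + 1), ∑ z ∈ box1 (d + 1), (if ((α = γ → x α = 0) ∧ (β = γ → z β = 0) ∧ (α = β → α ≠ γ → x α = z β)) then wilsonA d γ 0 x z (Sum.inl α) (Sum.inl β) else 0) := by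
        rw [Finset.mul_sum]
        refine Finset.sum_congr rfl fun x _ => ?_
        rw [Finset.mul_sum]
        refine Finset.sum_congr rfl fun z _ => ?_
        split_ifs <;> ring
    _ = 0 := by rw [hG, mul_zero]

end Assembly

end Summit.QuantumFields.BalabanUV.Beta.GAN24.WilsonThreeFaceGraded

end
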